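/-
Copyright (c) 2026 the pub-hodgecm-mathlib formalisation cell (harness21).  Prover seat hodgecm-mathlib-K2E5-p17 (g10), Track B ∕ K2-LIT, h413 = `stmt-HodgeConjecture-24833`,
R90-TF section S8 «ContSpec-n½ ∕ ResidualSpectrum», socket (M) `B :299`, W11 = «the (M) pen» (S8 dealer R90-CS-plan (g4) S8-R278; the file named by K2E1-p10 (g6)'s RESULT∕DONE
2026-09-05T03:55:23Z «NEXT FILE FOR WHOEVER TAKES THE PEN»): ★ `oneN_at_of_dictionary` ∕ ★ `oneS_at_of_dictionary` with ★ (D1) PLUGGED at the `L²` ambient.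
-/
import Summits.HodgeConjecture.HodgeConjecture.Theorems.R90S8ResMidOneConstituentSplitOfDictionaryU3   -- ★ p865229 (K2E1-p10): `oneS_at_of_dictionary`; brings ★ p865166 `oneN_at_of_dictionary` ((7d)-prep pair)
import Summits.HodgeConjecture.HodgeConjecture.Theorems.R90S8SmoothPartSubrepConstituentTransferU3    -- ★ p865275 (K2E1-p10): (D1) DISCHARGED — `isSmooth_rightRegular_fin_smoothPart_comp_inclPlace`, `DiscreteAutomorphicRep.comap_isConstituentOf_finRep_smoothPart_of_forall_mem_space`
import HarnessLib

/-!
# S8 (M) `B :299` — `R90S8ResMidOneConstituentOfL2DictionaryU3`: the letters (ONE-N) ∕ (ONE-S) of ED. 3 AT ONE PLACE from the DICTIONARY letters (D2)–(D3) ALONE, the ambient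
# `G_v`-module being THE SMOOTH VECTORS OF `L²(U(J₃)(L⁺)∖U(J₃)(𝔸_{L⁺}))` — ★ `oneN_at_of_dictionary` ∕ ★ `oneS_at_of_dictionary` with (D1) discharged by ★ p865275

Track B ∕ K2-LIT, crux h413 = `stmt-HodgeConjecture-24833`, route of record `HCCMUnconditional`; cell `hodgecm-mathlib`, R90-TF programme, section S8, the (M) socket road, RES-INT line 7.
THEOREMS ONLY (no `def`, no `instance`, no notation, no named-fact hypothesis, no `sorry`; default heartbeats except the two `set_option` lines inherited token for token from ★ p865166 ∕
★ p865229, whose statements spell ★ `cmPrincipalSeries` ∕ `parabolicIndGL … .twist …`); lane `--kind proof --supports stmt-HodgeConjecture-24833 --as helper` (count-neutral); imports ★ only.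
CLOSES NO SOCKET.

WHERE THIS SITS (K2E1-p10 (g6) RESULT∕DONE 03:55:23Z, the (M) column for the heir).  (M) :299 = ★ ED. 3 `res_middleResidue_isPiN_of_constituent` ∘ ★ {`oneN_at_of_dictionary`,
`oneS_at_of_dictionary`} ∘ ★ (D1) modulo per place {(D2) the SECTION DICTIONARY ∘ `Res` as intertwining maps `Φ_i` killing `K`, (D3) `hmeet` = (7d)} + printed {ORIENT, SPLIT-LQ, AFA}.  ★ p865166 ∕
★ p865229 are hypothesis-first on (D1)–(D3) over an ABSTRACT ambient `(X, ρ_v, P, hD1)`; ★ p865275 discharged (D1) at the adelic frame: the ambient is `ρ_v := ((R ∘ ι_f)^∞ ∘ inclPlace v)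
∘ (localPiEquiv v)⁻¹` on `X := ↥(R ∘ ι_f)^∞` (the `U(J₃)(𝔸_{L⁺,f})`-smooth vectors of `L²`, smooth by ★ `isSmooth_rightRegular_fin_smoothPart_comp_inclPlace`) and `P := Q`, ANY
`G_v`-subrepresentation of it whose vectors lie in `P′.space` (then (D1) is ★ `DiscreteAutomorphicRep.comap_isConstituentOf_finRep_smoothPart_of_forall_mem_space`).  THIS FILE is the
pure assembly: **`oneN_at_of_L2dictionary`** and **`oneS_at_of_L2dictionary`** = ★ p865166 ∕ ★ p865229 with the (D1) block REPLACED by `(Q, hQ)` and every other binder — `(μω ξ P′ v T a ha h)`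
resp. `(μω ξ P′ v hs)`, (D2) `K hK Φ hker` (now `Φ_i : I → ρ_v ∘ e` into the CONCRETE `L²` smooth module), (D3) `hmeet` (now «`Q` meets `⨆ range Φ_i`») — and the CONCLUSION byte for byte
those of the ★ letters (so ★ ED. 3's `hONEn` ∕ `hONEs` take them exactly as before).  After this file the (M) column's per-place residue is {(D2) (LH4-p10 ∕ K2Liu-p10 W8 letters:
dictionary `T`, FACT-N (a) ★, (c) at `v ∣ 𝔫` W3), (D3) `hmeet` (7d)} — (D1) is GONE from the visible surface.
HONEST LABEL: pays no socket and no printed citation; HC_CM is proved only modulo the 7 printed citations (2 remaining named inputs: hLiu418 = `stmt-HodgeConjecture-24832`, h413 =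
`stmt-HodgeConjecture-24833`) until rung 0 closes; (M) :299 stays `sorry`; REL ≠ ★ ≠ BUILT; count-neutral.

## References
* [Rogawski1990] J. D. Rogawski, *Automorphic Representations of Unitary Groups in Three Variables*, Ann. of Math. Stud. 123 (1990), §12.2 pp. 173–174; §13.1 p. 199.
* [BernsteinZelevinsky1976] I. N. Bernstein, A. V. Zelevinsky, *Representations of the group GL(n,F) where F is a non-archimedean local field*, Russian Math. Surveys 31:3 (1976), §2.1.
* [MoeglinWaldspurger1995] C. Mœglin, J.-L. Waldspurger, *Spectral Decomposition and Eisenstein Series* (1995), IV.1.11, V.3.13.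
* [BorelJacquet1979] A. Borel, H. Jacquet, *Automorphic forms and automorphic representations*, PSPM 33.1 (1979), §4.6 (smooth vectors of `L²`, local constituents).
-/

set_option autoImplicit false
-- the mandated namespace repeats the single-problem summit's segment (`HodgeConjecture.HodgeConjecture`)
set_option linter.dupNamespace false

noncomputable section

open MeasureTheory NumberField IsDedekindDomain
open scoped Matrix MatrixGroups
open Literature.NumberTheory.GaloisRepresentations Literature.NumberTheory.Automorphic.Arthur2013.Leaves.TECR
open Literature.NumberTheory.GaloisRepresentations.IsNonarchimedeanLocalField
open Literature.NumberTheory.Automorphic Literature.NumberTheory.Automorphic.UnitaryGroup Literature.NumberTheory.Rogawski1990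
open Literature.RepresentationTheory.Semisimple

namespace Summit.HodgeConjecture.HodgeConjecture.R90.S8

variable (L : Type) [Field L] [NumberField L] [IsCMField L]

/-! ## §1 (ONE-N) at one non-split place, (D1) discharged at the `L²` ambient -/

set_option synthInstance.maxHeartbeats 400000 in
set_option maxHeartbeats 4000000 in -- as ★ p865166 (the statement spells ★ `cmPrincipalSeries` + `Representation.quotient`)
/-- **(ONE-N) AT `(v, T, a, ha, h)` FROM (D2)–(D3), THE AMBIENT BEING THE SMOOTH VECTORS OF `L²`** — ★ `oneN_at_of_dictionary` with (D1) := ★ p865275: `ρ_v := ((R ∘ ι_f)^∞ ∘ inclPlace v) ∘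
(localPiEquiv v)⁻¹` (smooth, ★ `isSmooth_rightRegular_fin_smoothPart_comp_inclPlace`), `Q` any `G_v`-subrepresentation of the smooth vectors of `L²` lying in `P′.space` (`hQ`; the intended
`Q = P′^∞`), (D2) `K ≤ i_G(χ_{ξ,v})` with irreducible quotient and intertwining maps `Φ_i : i_G(χ_{ξ,v}) → ρ_v ∘ e` killing `K`, (D3) `Q` meets `⨆ range Φ_i` — conclusion = ★ ED. 3's `hONEn` ∃-body
BYTE FOR BYTE. [cite: Rogawski1990, §12.2 pp. 173–174; §13.1 p. 199] [cite: MoeglinWaldspurger1995, IV.1.11] [cite: BorelJacquet1979, §4.6] -/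
theorem oneN_at_of_L2dictionary
    {μ : Measure (quasiSplit (↥(maximalRealSubfield L)) L (IsCMField.complexConj L) 3).automorphicQuotient}
    [(quasiSplit (↥(maximalRealSubfield L)) L (IsCMField.complexConj L) 3).IsAutomorphicMeasure μ]
    (μω : HeckeCharacter L) (ξ : OneDimAutRepH L) (P' : DiscreteAutomorphicRep (quasiSplit (↥(maximalRealSubfield L)) L (IsCMField.complexConj L) 3) μ)
    (v : HeightOneSpectrum (𝓞 ↥(maximalRealSubfield L))) (T : GL (Fin 3) (LocalRing L v)) (a : LocalRing L v) (ha : IsUnit a)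
    (h : formCongr (conjLocal L (IsCMField.complexConj L) v) T (((StdForm.antidiagonal 3).over L).map (algebraMap L (LocalRing L v))) =
      a • (Matrix.of fun i j : Fin 3 => if i.val + j.val + 1 = 3 then (1 : L) else 0).map (algebraMap L (LocalRing L v)))
    -- (D1) DISCHARGED (★ p865275): the ambient is the smooth vectors of `L²`, `Q` any `G_v`-subrepresentation of them lying in `P′.space`
    (Q : Subrepresentation (((((Representation.smoothPart (((quasiSplit (↥(maximalRealSubfield L)) L (IsCMField.complexConj L) 3).rightRegular μ).toRepresentation.comp (finAdelicToAdelic (↥(maximalRealSubfield L)) L (IsCMField.complexConj L) 3 ((StdForm.antidiagonal 3).over L))))).toRepresentation).comp (inclPlace (↥(maximalRealSubfield L)) L (IsCMField.complexConj L) 3 ((StdForm.antidiagonal 3).over L) v)).comp ((localPiEquiv L (IsCMField.complexConj L) 3 ((StdForm.antidiagonal 3).over L) v).symm : «local» L (IsCMField.complexConj L) 3 ((StdForm.antidiagonal 3).over L) v →* ↥(localPi L (IsCMField.complexConj L) 3 ((StdForm.antidiagonal 3).over L) v))))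
    (hQ : ∀ x ∈ Q, ((x : ↥(Representation.smoothPart (((quasiSplit (↥(maximalRealSubfield L)) L (IsCMField.complexConj L) 3).rightRegular μ).toRepresentation.comp (finAdelicToAdelic (↥(maximalRealSubfield L)) L (IsCMField.complexConj L) 3 ((StdForm.antidiagonal 3).over L)))).toSubmodule) : (quasiSplit (↥(maximalRealSubfield L)) L (IsCMField.complexConj L) 3).L2 μ) ∈ P'.space.toSubmodule)
    -- (D2) the sub with irreducible quotient and the intertwining maps killing it
    (K : Subrepresentation (cmPrincipalSeries L 3 v (cmXiTorusChar L v (μω.semilocalComponent L v)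
      (torusLocalComponent L (IsCMField.complexConj L) v ξ.η) (torusLocalComponent L (IsCMField.complexConj L) v ξ.ψ))))
    (hK : K.quotientRep.IsIrreducible) {ι : Type*}
    (Φ : ι → (cmPrincipalSeries L 3 v (cmXiTorusChar L v (μω.semilocalComponent L v)
      (torusLocalComponent L (IsCMField.complexConj L) v ξ.η) (torusLocalComponent L (IsCMField.complexConj L) v ξ.ψ))).IntertwiningMap
        ((((((Representation.smoothPart (((quasiSplit (↥(maximalRealSubfield L)) L (IsCMField.complexConj L) 3).rightRegular μ).toRepresentation.comp (finAdelicToAdelic (↥(maximalRealSubfield L)) L (IsCMField.complexConj L) 3 ((StdForm.antidiagonal 3).over L))))).toRepresentation).comp (inclPlace (↥(maximalRealSubfield L)) L (IsCMField.complexConj L) 3 ((StdForm.antidiagonal 3).over L) v)).comp ((localPiEquiv L (IsCMField.complexConj L) 3 ((StdForm.antidiagonal 3).over L) v).symm : «local» L (IsCMField.complexConj L) 3 ((StdForm.antidiagonal 3).over L) v →* ↥(localPi L (IsCMField.complexConj L) 3 ((StdForm.antidiagonal 3).over L) v))).comp (cmDatumLocalCongr L v T ha h : Gqs L v →* (cmDatum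 L 3 ((StdForm.antidiagonal 3).over L)).Local v)))
    (hker : ∀ i, K ≤ (Φ i).ker)
    -- (D3) `P` meets the span of the images
    (hmeet : ∃ x ∈ Q, x ≠ 0 ∧ x ∈ ⨆ i, LinearMap.range (Φ i).toLinearMap) :
    ∃ c : IrrClass ((quasiSplit (↥(maximalRealSubfield L)) L (IsCMField.complexConj L) 3).Local v),
      (IrrClass.comap (localPiEquiv L (IsCMField.complexConj L) 3 ((StdForm.antidiagonal 3).over L) v) c).IsConstituentOf
          (P'.finRep.smoothPart.toRepresentation.comp
            (inclPlace (↥(maximalRealSubfield L)) L (IsCMField.complexConj L) 3 ((StdForm.antidiagonal 3).over L) v)) ∧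
        ∃ (r : SmoothIrrep (Gqs L v))
          (N : Subrepresentation (cmPrincipalSeries L 3 v (cmXiTorusChar L v (μω.semilocalComponent L v)
            (torusLocalComponent L (IsCMField.complexConj L) v ξ.η) (torusLocalComponent L (IsCMField.complexConj L) v ξ.ψ)))),
          IrrClass.comap (cmDatumLocalCongr L v T ha h) c = IrrClass.mk r ∧
          Nonempty (r.ρ.Equiv ((cmPrincipalSeries L 3 v (cmXiTorusChar L v (μω.semilocalComponent L v)
            (torusLocalComponent L (IsCMField.complexConj L) v ξ.η) (torusLocalComponent L (IsCMField.complexConj L) v ξ.ψ))).quotient N.toSubmodule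
              fun g _ hx => N.apply_mem_toSubmodule g hx)) :=
  oneN_at_of_dictionary L μω ξ P' v T a ha h (((((Representation.smoothPart (((quasiSplit (↥(maximalRealSubfield L)) L (IsCMField.complexConj L) 3).rightRegular μ).toRepresentation.comp (finAdelicToAdelic (↥(maximalRealSubfield L)) L (IsCMField.complexConj L) 3 ((StdForm.antidiagonal 3).over L))))).toRepresentation).comp (inclPlace (↥(maximalRealSubfield L)) L (IsCMField.complexConj L) 3 ((StdForm.antidiagonal 3).over L) v)).comp ((localPiEquiv L (IsCMField.complexConj L) 3 ((StdForm.antidiagonal 3).over L) v).symm : «local» L (IsCMField.complexConj L) 3 ((StdForm.antidiagonal 3).over L) v →* ↥(localPi L (IsCMField.complexConj L) 3 ((StdForm.antidiagonal 3).over L) v))) (isSmooth_rightRegular_fin_smoothPart_comp_inclPlace v) Q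
    (fun _ hc => DiscreteAutomorphicRep.comap_isConstituentOf_finRep_smoothPart_of_forall_mem_space P' v Q hQ hc) K hK Φ hker hmeet

/-! ## §2 (ONE-S) at one split place, (D1) discharged at the `L²` ambient -/

set_option synthInstance.maxHeartbeats 400000 in
set_option maxHeartbeats 4000000 in -- as ★ p865229 (the statement spells ★ `parabolicIndGL … .twist …` three times)
/-- **(ONE-S) AT A SPLIT PLACE `v` (`w ∣ v`, `c•w ≠ w`) FROM (D2)–(D3), THE AMBIENT BEING THE SMOOTH VECTORS OF `L²`** — ★ `oneS_at_of_dictionary` with (D1) := ★ p865275 as in §1; (D2) the sub `K`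
of the split principal series `I(ν₀ν^{½}, χ′, ν₀ν^{−½})` of `GL₃(L_w)` with irreducible quotient and intertwining maps `Φ_i : I → ρ_v ∘ e_w⁻¹` killing `K`, (D3) `Q` meets `⨆ range Φ_i` —
conclusion = ★ ED. 3's `hONEs` ∃-body BYTE FOR BYTE. [cite: Rogawski1990, §12.2 pp. 173–174] [cite: BernsteinZelevinsky1976, §2.1] [cite: BorelJacquet1979, §4.6] -/
theorem oneS_at_of_L2dictionary
    {μ : Measure (quasiSplit (↥(maximalRealSubfield L)) L (IsCMField.complexConj L) 3).automorphicQuotient}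
    [(quasiSplit (↥(maximalRealSubfield L)) L (IsCMField.complexConj L) 3).IsAutomorphicMeasure μ]
    (μω : HeckeCharacter L) (ξ : OneDimAutRepH L) (P' : DiscreteAutomorphicRep (quasiSplit (↥(maximalRealSubfield L)) L (IsCMField.complexConj L) 3) μ)
    (v : HeightOneSpectrum (𝓞 ↥(maximalRealSubfield L))) (hs : ∃ w : PlacesOver L v, IsCMField.complexConj L • w.1 ≠ w.1)
    -- (D1) DISCHARGED (★ p865275): the ambient is the smooth vectors of `L²`, `Q` any `G_v`-subrepresentation of them lying in `P′.space`
    (Q : Subrepresentation (((((Representation.smoothPart (((quasiSplit (↥(maximalRealSubfield L)) L (IsCMField.complexConj L) 3).rightRegular μ).toRepresentation.comp (finAdelicToAdelic (↥(maximalRealSubfield L)) L (IsCMField.complexConj L) 3 ((StdForm.antidiagonal 3).over L))))).toRepresentation).comp (inclPlace (↥(maximalRealSubfield L)) L (IsCMField.complexConj L) 3 ((StdForm.antidiagonal 3).over L) v)).comp ((localPiEquiv L (IsCMField.complexConj L) 3 ((StdForm.antidiagonal 3).over L) v).symm : «local» L (IsCMField.complexConj L) 3 ((StdForm.antidiagonal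 3).over L) v →* ↥(localPi L (IsCMField.complexConj L) 3 ((StdForm.antidiagonal 3).over L) v))))
    (hQ : ∀ x ∈ Q, ((x : ↥(Representation.smoothPart (((quasiSplit (↥(maximalRealSubfield L)) L (IsCMField.complexConj L) 3).rightRegular μ).toRepresentation.comp (finAdelicToAdelic (↥(maximalRealSubfield L)) L (IsCMField.complexConj L) 3 ((StdForm.antidiagonal 3).over L)))).toSubmodule) : (quasiSplit (↥(maximalRealSubfield L)) L (IsCMField.complexConj L) 3).L2 μ) ∈ P'.space.toSubmodule)
    -- (D2) the sub of the split principal series with irreducible quotient and the intertwining maps killing it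
    (K : Subrepresentation (Representation.parabolicIndGL ((splitWitness v hs).1.adicCompletion L) (id : Fin 3 → Fin 3)
          ((Representation.trivial ℂ (Π a : Fin 3, GL {i : Fin 3 // (id : Fin 3 → Fin 3) i = a} ((splitWitness v hs).1.adicCompletion L)) ℂ).twist
          (∏ a : Fin 3, ((![ξ.splitν₀ μω (splitWitness v hs).1 *
          ((unramifiedTwist ((splitWitness v hs).1.adicCompletion L) (1 / 2) : QuasiChar ((splitWitness v hs).1.adicCompletion L)).toMonoidHom),
          ξ.locψ (splitWitness v hs).1,
          ξ.splitν₀ μω (splitWitness v hs).1 *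
          ((unramifiedTwist ((splitWitness v hs).1.adicCompletion L) (1 / 2) : QuasiChar ((splitWitness v hs).1.adicCompletion L)).toMonoidHom)⁻¹] :
          Fin 3 → (((splitWitness v hs).1.adicCompletion L)ˣ →* ℂˣ)) a).comp
          (Matrix.GeneralLinearGroup.det.comp (Pi.evalMonoidHom (fun a : Fin 3 => GL {i : Fin 3 // (id : Fin 3 → Fin 3) i = a} ((splitWitness v hs).1.adicCompletion L)) a))))))
    (hK : K.quotientRep.IsIrreducible) {ι : Type*}
    (Φ : ι → (Representation.parabolicIndGL ((splitWitness v hs).1.adicCompletion L) (id : Fin 3 → Fin 3)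
          ((Representation.trivial ℂ (Π a : Fin 3, GL {i : Fin 3 // (id : Fin 3 → Fin 3) i = a} ((splitWitness v hs).1.adicCompletion L)) ℂ).twist
          (∏ a : Fin 3, ((![ξ.splitν₀ μω (splitWitness v hs).1 *
          ((unramifiedTwist ((splitWitness v hs).1.adicCompletion L) (1 / 2) : QuasiChar ((splitWitness v hs).1.adicCompletion L)).toMonoidHom),
          ξ.locψ (splitWitness v hs).1,
          ξ.splitν₀ μω (splitWitness v hs).1 *
          ((unramifiedTwist ((splitWitness v hs).1.adicCompletion L) (1 / 2) : QuasiChar ((splitWitness v hs).1.adicCompletion L)).toMonoidHom)⁻¹] :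
          Fin 3 → (((splitWitness v hs).1.adicCompletion L)ˣ →* ℂˣ)) a).comp
          (Matrix.GeneralLinearGroup.det.comp (Pi.evalMonoidHom (fun a : Fin 3 => GL {i : Fin 3 // (id : Fin 3 → Fin 3) i = a} ((splitWitness v hs).1.adicCompletion L)) a))))).IntertwiningMap
        ((((((Representation.smoothPart (((quasiSplit (↥(maximalRealSubfield L)) L (IsCMField.complexConj L) 3).rightRegular μ).toRepresentation.comp (finAdelicToAdelic (↥(maximalRealSubfield L)) L (IsCMField.complexConj L) 3 ((StdForm.antidiagonal 3).over L))))).toRepresentation).comp (inclPlace (↥(maximalRealSubfield L)) L (IsCMField.complexConj L) 3 ((StdForm.antidiagonal 3).over L) v)).comp ((localPiEquiv L (IsCMField.complexConj L) 3 ((StdForm.antidiagonal 3).over L) v).symm : «local» L (IsCMField.complexConj L) 3 ((StdForm.antidiagonal 3).over L) v →* ↥(localPi L (IsCMField.complexConj L) 3 ((StdForm.antidiagonal 3).over L) v))).comp ((cmSplitEquiv L ((StdForm.antidiagonal 3).over L) (UnitaryGroup.cmConj_antidiagonal_transpose L 3) ((Matrix.isUnit_iff_isUnit_det _).mp (StdForm.isUnit_over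 (StdForm.antidiagonal 3) L)) v (splitWitness v hs) (splitWitness_spec v hs)).symm :
          GL (Fin 3) ((splitWitness v hs).1.adicCompletion L) →* (cmDatum L 3 ((StdForm.antidiagonal 3).over L)).Local v)))
    (hker : ∀ i, K ≤ (Φ i).ker)
    -- (D3) `P` meets the span of the images
    (hmeet : ∃ x ∈ Q, x ≠ 0 ∧ x ∈ ⨆ i, LinearMap.range (Φ i).toLinearMap) :
    ∃ c : IrrClass ((quasiSplit (↥(maximalRealSubfield L)) L (IsCMField.complexConj L) 3).Local v),
      (IrrClass.comap (localPiEquiv L (IsCMField.complexConj L) 3 ((StdForm.antidiagonal 3).over L) v) c).IsConstituentOf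
          (P'.finRep.smoothPart.toRepresentation.comp
            (inclPlace (↥(maximalRealSubfield L)) L (IsCMField.complexConj L) 3 ((StdForm.antidiagonal 3).over L) v)) ∧
        ∃ (π : SmoothIrrep ((cmDatum L 3 ((StdForm.antidiagonal 3).over L)).Local v)), IrrClass.mk π = c ∧
          ∃ q : (Representation.parabolicIndGL ((splitWitness v hs).1.adicCompletion L) (id : Fin 3 → Fin 3)
          ((Representation.trivial ℂ (Π a : Fin 3, GL {i : Fin 3 // (id : Fin 3 → Fin 3) i = a} ((splitWitness v hs).1.adicCompletion L)) ℂ).twist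
          (∏ a : Fin 3, ((![ξ.splitν₀ μω (splitWitness v hs).1 *
          ((unramifiedTwist ((splitWitness v hs).1.adicCompletion L) (1 / 2) : QuasiChar ((splitWitness v hs).1.adicCompletion L)).toMonoidHom),
          ξ.locψ (splitWitness v hs).1,
          ξ.splitν₀ μω (splitWitness v hs).1 *
          ((unramifiedTwist ((splitWitness v hs).1.adicCompletion L) (1 / 2) : QuasiChar ((splitWitness v hs).1.adicCompletion L)).toMonoidHom)⁻¹] :
          Fin 3 → (((splitWitness v hs).1.adicCompletion L)ˣ →* ℂˣ)) a).comp
          (Matrix.GeneralLinearGroup.det.comp (Pi.evalMonoidHom (fun a : Fin 3 => GL {i : Fin 3 // (id : Fin 3 → Fin 3) i = a} ((splitWitness v hs).1.adicCompletion L)) a))))).IntertwiningMap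
              (π.comap (cmSplitEquiv L ((StdForm.antidiagonal 3).over L) (UnitaryGroup.cmConj_antidiagonal_transpose L 3) ((Matrix.isUnit_iff_isUnit_det _).mp (StdForm.isUnit_over (StdForm.antidiagonal 3) L)) v (splitWitness v hs) (splitWitness_spec v hs)).symm).ρ,
            Function.Surjective q :=
  oneS_at_of_dictionary L μω ξ P' v hs (((((Representation.smoothPart (((quasiSplit (↥(maximalRealSubfield L)) L (IsCMField.complexConj L) 3).rightRegular μ).toRepresentation.comp (finAdelicToAdelic (↥(maximalRealSubfield L)) L (IsCMField.complexConj L) 3 ((StdForm.antidiagonal 3).over L))))).toRepresentation).comp (inclPlace (↥(maximalRealSubfield L)) L (IsCMField.complexConj L) 3 ((StdForm.antidiagonal 3).over L) v)).comp ((localPiEquiv L (IsCMField.complexConj L) 3 ((StdForm.antidiagonal 3).over L) v).symm : «local» L (IsCMField.complexConj L) 3 ((StdForm.antidiagonal 3).over L) v →* ↥(localPi L (IsCMField.complexConj L) 3 ((StdForm.antidiagonal 3).over L) v))) (isSmooth_rightRegular_fin_smoothPart_comp_inclPlace v) Q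
    (fun _ hc => DiscreteAutomorphicRep.comap_isConstituentOf_finRep_smoothPart_of_forall_mem_space P' v Q hQ hc) K hK Φ hker hmeet

end Summit.HodgeConjecture.HodgeConjecture.R90.S8

end
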